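import Summits.MatrixMultiplication.MatrixMultiplication.Theorems.AbelianSTPPCensusFP4Label
import Summits.MatrixMultiplication.MatrixMultiplication.Theorems.AbelianSTPPCensusGW2Class

/-!
# Rule U11-F4 (Pollard fibred over the Sylow subgroup at `M = 4p`) is SOUND: `IsSTPP ⇒ FP4Adm`

Cell mm-stpp (rung F-M1), theory lane «past the quartet's walls» (seat mm-stpp-theory, gen 17).  The shape-level predicate `FP4.FP4Adm`
(`AbelianSTPPCensusFP4Defs.lean`) holds on the shape data of every STPP family with non-empty sets in a finite abelian group `H`:
`FP4.fp4Adm_of_isSTPP` / `FP4.fp4Sound` (the census's item format, like `FP2.fp2Sound`, `GW2.gw2Sound`).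

PROOF.  Nothing to show unless `|H| = 4p`, `p` an odd prime.  Then `AbelianSTPPCensusFP4Label` provides a subgroup `P` of order `p` and a
labelling `lab : H → {0,1,2,3}` of its four cosets with `lab (u + v) = addQ e (lab u) (lab v)`, `e ∈ {0,1}`.  With `X = ⋃(B − A)`,
`Y = ⋃(C − B)`, `Z′ = ⋃(C − A)` (tree `diffUnion`, sizes `P_AB, P_BC, P_CA`, `r_{X,Y} = b_i` on `C_i − A_i` by `STPPRepCount.repCount_eq`) and
their class counts `cnt X, cnt Y, cnt Z′ : Q4`:
* the classes of `X`, `Y` have `≤ p` elements (each lies in a translate of `P`) and the counts sum to the totals;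
* target class `c`: the pairs `(X_g, Y_{c−g})` have all sums in class `c`, the four restricted representation counts add up to EXACTLY
  `r_{X,Y}` on class `c` (below: `≤` from disjointness, `≥` because `lab x + lab y = c` forces `lab y = c − lab x`), so
  (F1) is FP2's coset argument with four Pollard floors (`FP2.pairFloor_le_Nt_coset`, Pollard in `↥P ≃+ ℤ/p`) under the common ceiling
  `W·min(T, cap) + T·(p − W)`, (F2) sums `vmin ≤ r` over the target class, (F3) reads one target point (`GW2.repCount_le_card_left/right`), (F4) is the class bound;
* forms A and C are form B of the rotated families `(C, A, B)`, `(B, C, A)` (`IsSTPP.rotate`), the classes of `⋃(A − C) = −Z′` etc. being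
  the `negQ`-permuted classes of `Z′` (`FP4.cnt_image_neg`).
WHAT THIS IS NOT: no census number and no `ω` statement — a necessary condition; silent at orders not of the form `4p`.  References:
J. M. Pollard, J. London Math. Soc. (2) 8 (1974) 460–462 (tree `Literature.Combinatorics.Additive.pollard`); CKSU 2005 Def. 5.1 (`IsSTPP`).
-/

set_option linter.dupNamespace false -- `MatrixMultiplication.MatrixMultiplication` (summit = problem, D-0017)
set_option autoImplicit false

namespace Summit.MatrixMultiplication.MatrixMultiplication.Theorems

open Finset

namespace FP4

section Sound

open Literature.Computability.AlgebraicComplexity STPPRepCount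
open scoped Pointwise

variable {H : Type*} [AddCommGroup H] [Fintype H] {p : ℕ} (L : Lab H p)

/-! ### Class counts -/

/-- The class of label `l` of a finset. [bookkeeping] -/
def Lab.cls (S : Finset H) (l : ℕ) : Finset H := S.filter (fun u => L.lab u = l)

/-- The four class counts of a finset. [bookkeeping] -/
def Lab.cnt (S : Finset H) : Q4 := ⟨(L.cls S 0).card, (L.cls S 1).card, (L.cls S 2).card, (L.cls S 3).card⟩

/-- Reading a class count. [bookkeeping] -/
theorem Lab.cnt_get (S : Finset H) {l : ℕ} (hl : l < 4) : (L.cnt S).get l = (L.cls S l).card := by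
  unfold Lab.cnt
  match l, hl with
  | 0, _ => rfl
  | 1, _ => rfl
  | 2, _ => rfl
  | 3, _ => rfl

/-- The class counts sum to the size. [bookkeeping] -/
theorem Lab.cnt_sum (S : Finset H) : (L.cnt S).sum = S.card := by
  unfold Lab.cnt Q4.sum Lab.cls
  rw [L.card_eq_sum_filter S]

/-- Each class count is `≤ p`. [bookkeeping] -/
theorem Lab.cnt_get_le (S : Finset H) {l : ℕ} (hl : l < 4) : (L.cnt S).get l ≤ p := by
  rw [L.cnt_get S hl]; exact L.card_filter_le S l

/-- Membership in a class. [bookkeeping] -/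
theorem Lab.mem_cls {S : Finset H} {l : ℕ} {u : H} : u ∈ L.cls S l ↔ u ∈ S ∧ L.lab u = l := by
  unfold Lab.cls; rw [mem_filter]

variable [DecidableEq H]

/-- Class counts of a negated set are the `negQ`-permuted class counts. [bookkeeping] -/
theorem Lab.cnt_image_neg (S : Finset H) : L.cnt (S.image (fun u => -u)) = (L.cnt S).neg L.e := by
  have h := fun l (hl : l < 4) => L.card_filter_neg S hl
  have hn : ∀ l, l < 4 → negQ L.e l < 4 := by
    have : ∀ e < 2, ∀ l < 4, negQ e l < 4 := by decide
    exact this L.e (by have := L.e_le; omega)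
  unfold Q4.neg
  rw [L.cnt_get S (hn 0 (by omega)), L.cnt_get S (hn 1 (by omega)), L.cnt_get S (hn 2 (by omega)), L.cnt_get S (hn 3 (by omega))]
  unfold Lab.cnt Lab.cls
  rw [h 0 (by omega), h 1 (by omega), h 2 (by omega), h 3 (by omega)]

/-- Membership in the solution set of one class pair. [bookkeeping] -/
theorem Lab.mem_pairSol {X Y : Finset H} {c g : ℕ} {w : H} {q : H × H} :
    q ∈ (L.cls X g ×ˢ L.cls Y (subQ L.e c g)).filter (fun q => q.1 + q.2 = w) ↔
      ((q.1 ∈ X ∧ L.lab q.1 = g) ∧ (q.2 ∈ Y ∧ L.lab q.2 = subQ L.e c g)) ∧ q.1 + q.2 = w := by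
  rw [mem_filter, mem_product, L.mem_cls, L.mem_cls]

/-! ### Representation counts split by classes -/

/-- Table facts: `g + (c − g) = c`, and `g + b = c` forces `b = c − g`. [bookkeeping] -/
theorem addQ_subQ_facts {e : ℕ} (he : e ≤ 1) :
    (∀ c, c < 4 → ∀ g, g < 4 → addQ e g (subQ e c g) = c) ∧
      (∀ c, c < 4 → ∀ g, g < 4 → ∀ b, b < 4 → addQ e g b = c → b = subQ e c g) ∧ (∀ c, c < 4 → ∀ g, g < 4 → subQ e c g < 4) := by
  have h1 : ∀ e < 2, ∀ c < 4, ∀ g < 4, addQ e g (subQ e c g) = c := by decide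
  have h2 : ∀ e < 2, ∀ c < 4, ∀ g < 4, ∀ b < 4, addQ e g b = c → b = subQ e c g := by decide
  have h3 : ∀ e < 2, ∀ c < 4, ∀ g < 4, subQ e c g < 4 := by decide
  exact ⟨h1 e (by omega), h2 e (by omega), h3 e (by omega)⟩

/-- Sums of the pair `(U_g, V_{c−g})` lie in class `c`: the restricted count vanishes off class `c`. [bookkeeping] -/
theorem Lab.repCount_cls_eq_zero (X Y : Finset H) {c g : ℕ} (hc : c < 4) (hg : g < 4) {w : H} (hw : L.lab w ≠ c) :
    repCount (L.cls X g) (L.cls Y (subQ L.e c g)) w = 0 := by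
  refine FP2.repCount_eq_zero fun u hu y hy huy => hw ?_
  rw [L.mem_cls] at hu hy
  rw [← huy, L.lab_add, hu.2, hy.2]
  exact (addQ_subQ_facts L.e_le).1 c hc g hg

/-- The four restricted counts of target `c` are jointly below `r_{X,Y}` (the pair sets are disjoint parts of `X × Y`). [bookkeeping] -/
theorem Lab.sum_repCount_cls_le (X Y : Finset H) (c : ℕ) (w : H) :
    repCount (L.cls X 0) (L.cls Y (subQ L.e c 0)) w + repCount (L.cls X 1) (L.cls Y (subQ L.e c 1)) w +
      repCount (L.cls X 2) (L.cls Y (subQ L.e c 2)) w + repCount (L.cls X 3) (L.cls Y (subQ L.e c 3)) w ≤ repCount X Y w := by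
  unfold repCount
  set T : ℕ → Finset (H × H) := fun g => (L.cls X g ×ˢ L.cls Y (subQ L.e c g)).filter (fun q => q.1 + q.2 = w) with hT
  have hsub : ∀ g, T g ⊆ (X ×ˢ Y).filter (fun q => q.1 + q.2 = w) := by
    intro g q hq
    rw [hT, L.mem_pairSol] at hq
    rw [mem_filter, mem_product]
    exact ⟨⟨hq.1.1.1, hq.1.2.1⟩, hq.2⟩
  have hdis : ∀ g g', g ≠ g' → Disjoint (T g) (T g') := by
    intro g g' hne
    rw [Finset.disjoint_left]
    intro q hq hq'
    rw [hT, L.mem_pairSol] at hq hq'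
    exact hne (hq.1.1.2.symm.trans hq'.1.1.2)
  have hu : (T 0 ∪ T 1 ∪ T 2 ∪ T 3) ⊆ (X ×ˢ Y).filter (fun q => q.1 + q.2 = w) :=
    union_subset (union_subset (union_subset (hsub 0) (hsub 1)) (hsub 2)) (hsub 3)
  have h01 : Disjoint (T 0) (T 1) := hdis 0 1 (by omega)
  have h012 : Disjoint (T 0 ∪ T 1) (T 2) := disjoint_union_left.mpr ⟨hdis 0 2 (by omega), hdis 1 2 (by omega)⟩
  have h0123 : Disjoint (T 0 ∪ T 1 ∪ T 2) (T 3) :=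
    disjoint_union_left.mpr ⟨disjoint_union_left.mpr ⟨hdis 0 3 (by omega), hdis 1 3 (by omega)⟩, hdis 2 3 (by omega)⟩
  have := card_le_card hu
  rw [card_union_of_disjoint h0123, card_union_of_disjoint h012, card_union_of_disjoint h01] at this
  exact this

/-- On class `c` the four restricted counts add up to AT LEAST `r_{X,Y}` (a pair `x + y = w` with `lab w = c` has `lab y = c − lab x`).
[bookkeeping] -/
theorem Lab.repCount_le_sum_cls (X Y : Finset H) {c : ℕ} (hc : c < 4) {w : H} (hw : L.lab w = c) :
    repCount X Y w ≤ repCount (L.cls X 0) (L.cls Y (subQ L.e c 0)) w + repCount (L.cls X 1) (L.cls Y (subQ L.e c 1)) w +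
      repCount (L.cls X 2) (L.cls Y (subQ L.e c 2)) w + repCount (L.cls X 3) (L.cls Y (subQ L.e c 3)) w := by
  unfold repCount
  set T : ℕ → Finset (H × H) := fun g => (L.cls X g ×ˢ L.cls Y (subQ L.e c g)).filter (fun q => q.1 + q.2 = w) with hT
  have hcov : (X ×ˢ Y).filter (fun q => q.1 + q.2 = w) ⊆ T 0 ∪ T 1 ∪ T 2 ∪ T 3 := by
    intro q hq
    rw [mem_filter, mem_product] at hq
    have hl := L.lab_lt q.1
    have hy : L.lab q.2 = subQ L.e c (L.lab q.1) := by
      refine (addQ_subQ_facts L.e_le).2.1 c hc _ hl _ (L.lab_lt q.2) ?_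
      rw [← L.lab_add, hq.2, hw]
    have hmem : q ∈ T (L.lab q.1) := by
      rw [hT, L.mem_pairSol]
      exact ⟨⟨⟨hq.1.1, rfl⟩, ⟨hq.1.2, hy⟩⟩, hq.2⟩
    have hl' : L.lab q.1 = 0 ∨ L.lab q.1 = 1 ∨ L.lab q.1 = 2 ∨ L.lab q.1 = 3 := by omega
    rcases hl' with h | h | h | h <;> rw [h] at hmem <;> simp only [mem_union] <;> tauto
  calc ((X ×ˢ Y).filter (fun q => q.1 + q.2 = w)).card ≤ (T 0 ∪ T 1 ∪ T 2 ∪ T 3).card := card_le_card hcov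
    _ ≤ (T 0 ∪ T 1 ∪ T 2).card + (T 3).card := card_union_le _ _
    _ ≤ (T 0 ∪ T 1).card + (T 2).card + (T 3).card := by have := card_union_le (T 0 ∪ T 1) (T 2); omega
    _ ≤ (T 0).card + (T 1).card + (T 2).card + (T 3).card := by have := card_union_le (T 0) (T 1); omega

/-! ### The three target conditions, abstractly -/

/-- **(F1) for one target class.**  Four pairs inside coset pairs of `P` (`|P| = p` prime), all their sums in `Q` (`|Q| ≤ p`), jointly
dominated by `r = r_{X,Y}`, target `Zq ⊆ Q` with `r ≤ v` on it: `F1 p v |Zq| |U0| |V0| … |U3| |V3|`.  (FP2's `cosetIneq_of` with four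
floors.) [original] -/
theorem f1_of (P : AddSubgroup H) [DecidablePred (· ∈ P)] [Fact p.Prime] (hP : (univ.filter (· ∈ P)).card = p)
    (U0 V0 U1 V1 U2 V2 U3 V3 X Y Q Zq : Finset H) (v : ℕ) (a0 b0 a1 b1 a2 b2 a3 b3 : H)
    (hU0 : ∀ u ∈ U0, u - a0 ∈ P) (hV0 : ∀ u ∈ V0, u - b0 ∈ P) (hU1 : ∀ u ∈ U1, u - a1 ∈ P) (hV1 : ∀ u ∈ V1, u - b1 ∈ P)
    (hU2 : ∀ u ∈ U2, u - a2 ∈ P) (hV2 : ∀ u ∈ V2, u - b2 ∈ P) (hU3 : ∀ u ∈ U3, u - a3 ∈ P) (hV3 : ∀ u ∈ V3, u - b3 ∈ P)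
    (hsupp : ∀ w, w ∉ Q → repCount U0 V0 w = 0 ∧ repCount U1 V1 w = 0 ∧ repCount U2 V2 w = 0 ∧ repCount U3 V3 w = 0)
    (hdom : ∀ w, repCount U0 V0 w + repCount U1 V1 w + repCount U2 V2 w + repCount U3 V3 w ≤ repCount X Y w)
    (hQ : Q.card ≤ p) (hZq : Zq ⊆ Q) (hv : ∀ w ∈ Zq, repCount X Y w ≤ v) :
    ∀ s0 s1 s2 s3 : ℕ, s0 ≤ U0.card → s0 ≤ V0.card → s1 ≤ U1.card → s1 ≤ V1.card → s2 ≤ U2.card → s2 ≤ V2.card →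
      s3 ≤ U3.card → s3 ≤ V3.card →
      FP2.pairFloor p U0.card V0.card s0 + FP2.pairFloor p U1.card V1.card s1 + FP2.pairFloor p U2.card V2.card s2 +
          FP2.pairFloor p U3.card V3.card s3 ≤
        Zq.card * min (s0 + s1 + s2 + s3) v + (s0 + s1 + s2 + s3) * (p - Zq.card) := by
  intro s0 s1 s2 s3 c0 d0 c1 d1 c2 d2 c3 d3
  have e0 := FP2.pairFloor_le_Nt_coset P hP a0 b0 hU0 hV0 c0 d0
  have e1 := FP2.pairFloor_le_Nt_coset P hP a1 b1 hU1 hV1 c1 d1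
  have e2 := FP2.pairFloor_le_Nt_coset P hP a2 b2 hU2 hV2 c2 d2
  have e3 := FP2.pairFloor_le_Nt_coset P hP a3 b3 hU3 hV3 c3 d3
  have hNt : ∀ (S T : Finset H) (s : ℕ), (∀ w, w ∉ Q → repCount S T w = 0) → Nt S T s = ∑ w ∈ Q, min s (repCount S T w) := by
    intro S T s hz
    unfold Nt
    rw [← sum_filter_add_sum_filter_not univ (· ∈ Q)]
    have hz' : ∑ w ∈ univ.filter (fun w => ¬ w ∈ Q), min s (repCount S T w) = 0 :=
      sum_eq_zero fun w hw => by rw [hz w (mem_filter.mp hw).2, Nat.min_zero]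
    rw [hz', add_zero, filter_mem_eq_inter, univ_inter]
  rw [hNt U0 V0 s0 fun w hw => (hsupp w hw).1] at e0
  rw [hNt U1 V1 s1 fun w hw => (hsupp w hw).2.1] at e1
  rw [hNt U2 V2 s2 fun w hw => (hsupp w hw).2.2.1] at e2
  rw [hNt U3 V3 s3 fun w hw => (hsupp w hw).2.2.2] at e3
  set T := s0 + s1 + s2 + s3 with hTdef
  have step : FP2.pairFloor p U0.card V0.card s0 + FP2.pairFloor p U1.card V1.card s1 + FP2.pairFloor p U2.card V2.card s2 +
      FP2.pairFloor p U3.card V3.card s3 ≤ ∑ w ∈ Q, min T (repCount X Y w) := by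
    refine (Nat.add_le_add (Nat.add_le_add (Nat.add_le_add e0 e1) e2) e3).trans ?_
    rw [← sum_add_distrib, ← sum_add_distrib, ← sum_add_distrib]
    refine sum_le_sum fun w _ => ?_
    have := hdom w
    omega
  refine step.trans ?_
  rw [← sum_sdiff hZq]
  have hA : ∑ w ∈ Q \ Zq, min T (repCount X Y w) ≤ T * (p - Zq.card) := by
    calc ∑ w ∈ Q \ Zq, min T (repCount X Y w) ≤ ∑ w ∈ Q \ Zq, T := sum_le_sum fun w _ => min_le_left _ _
      _ = T * (Q.card - Zq.card) := by rw [sum_const, smul_eq_mul, card_sdiff_of_subset hZq, mul_comm]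
      _ ≤ T * (p - Zq.card) := Nat.mul_le_mul_left _ (by omega)
  have hB : ∑ w ∈ Zq, min T (repCount X Y w) ≤ Zq.card * min T v := by
    calc ∑ w ∈ Zq, min T (repCount X Y w) ≤ ∑ w ∈ Zq, min T v := sum_le_sum fun w hw => min_le_min_left _ (hv w hw)
      _ = Zq.card * min T v := by rw [sum_const, smul_eq_mul]
  omega

/-- **(F2) for one target class**: if on `Q` the count `r` is below the sum of the four restricted counts and `vmin ≤ r` on `Zq ⊆ Q`, then
`vmin·|Zq| ≤ Σ_g |U_g||V_g|`. [original] -/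
theorem f2_of (U0 V0 U1 V1 U2 V2 U3 V3 X Y Q Zq : Finset H) (vmin : ℕ)
    (hle : ∀ w ∈ Q, repCount X Y w ≤ repCount U0 V0 w + repCount U1 V1 w + repCount U2 V2 w + repCount U3 V3 w)
    (hZq : Zq ⊆ Q) (hpos : ∀ w ∈ Zq, vmin ≤ repCount X Y w) :
    vmin * Zq.card ≤ U0.card * V0.card + U1.card * V1.card + U2.card * V2.card + U3.card * V3.card := by
  have hs : ∀ (S T : Finset H), ∑ w ∈ Q, repCount S T w ≤ S.card * T.card := fun S T => by
    rw [← FP2.sum_repCount S T]; exact sum_le_sum_of_subset (subset_univ _)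
  calc vmin * Zq.card = ∑ w ∈ Zq, vmin := by rw [sum_const, smul_eq_mul, mul_comm]
    _ ≤ ∑ w ∈ Zq, repCount X Y w := sum_le_sum hpos
    _ ≤ ∑ w ∈ Q, repCount X Y w := sum_le_sum_of_subset hZq
    _ ≤ ∑ w ∈ Q, (repCount U0 V0 w + repCount U1 V1 w + repCount U2 V2 w + repCount U3 V3 w) := sum_le_sum hle
    _ = ∑ w ∈ Q, repCount U0 V0 w + ∑ w ∈ Q, repCount U1 V1 w + ∑ w ∈ Q, repCount U2 V2 w + ∑ w ∈ Q, repCount U3 V3 w := by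
        rw [sum_add_distrib, sum_add_distrib, sum_add_distrib]
    _ ≤ _ := Nat.add_le_add (Nat.add_le_add (Nat.add_le_add (hs U0 V0) (hs U1 V1)) (hs U2 V2)) (hs U3 V3)

/-! ### Form B of an STPP family -/

variable {N : ℕ} {A B C : Fin N → Finset H}

/-- **One target class of form B for an STPP family** (non-empty sets): `TargetOK` at the true class counts. [original] -/
theorem Lab.targetOK_of_isSTPP (h : IsSTPP A B C) (hp : p.Prime) {vb : ℕ} (hvb : ∀ i, vb ≤ (B i).card) {c : ℕ} (hc : c < 4) :
    TargetOK p L.e (univ.sup fun i => (B i).card) vb (L.cnt (diffUnion A B)) (L.cnt (diffUnion B C)) c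
      ((L.cnt (diffUnion A C)).get c) := by
  classical
  haveI : Fact p.Prime := ⟨hp⟩
  set X := diffUnion A B; set Y := diffUnion B C; set Z := diffUnion A C
  set v := univ.sup fun i => (B i).card
  have he := L.e_le
  obtain ⟨-, -, hs3⟩ := addQ_subQ_facts he
  -- the representation count on `Z′`
  have hrZ : ∀ w ∈ Z, repCount X Y w ≤ v ∧ vb ≤ repCount X Y w := by
    intro w hw
    simp only [Z, diffUnion, mem_biUnion, mem_univ, true_and] at hw
    obtain ⟨i, hi⟩ := hw
    rw [mem_sub] at hi
    obtain ⟨c', hc', a, ha, rfl⟩ := hi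
    rw [repCount_eq h ha hc']
    exact ⟨le_sup (f := fun i => (B i).card) (mem_univ i), hvb i⟩
  -- the objects of the target class
  set Q : Finset H := univ.filter (fun w => L.lab w = c)
  set Zq := L.cls Z c
  have hZq : Zq ⊆ Q := fun w hw => by
    rw [L.mem_cls] at hw; exact mem_filter.mpr ⟨mem_univ _, hw.2⟩
  have hQ : Q.card ≤ p := L.card_filter_le univ c
  -- rewrite the class counts
  have gx : ∀ g, g < 4 → (L.cnt X).get g = (L.cls X g).card := fun g hg => L.cnt_get X hg
  have gy : ∀ g, g < 4 → (L.cnt Y).get (subQ L.e c g) = (L.cls Y (subQ L.e c g)).card := fun g hg => L.cnt_get Y (hs3 c hc g hg)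
  unfold TargetOK
  rw [L.cnt_get Z hc, gx 0 (by omega), gx 1 (by omega), gx 2 (by omega), gx 3 (by omega), gy 0 (by omega), gy 1 (by omega),
    gy 2 (by omega), gy 3 (by omega)]
  have hdomle : ∀ w, repCount (L.cls X 0) (L.cls Y (subQ L.e c 0)) w + repCount (L.cls X 1) (L.cls Y (subQ L.e c 1)) w +
      repCount (L.cls X 2) (L.cls Y (subQ L.e c 2)) w + repCount (L.cls X 3) (L.cls Y (subQ L.e c 3)) w ≤ repCount X Y w :=
    fun w => L.sum_repCount_cls_le X Y c w
  have hdomge : ∀ w ∈ Q, repCount X Y w ≤ repCount (L.cls X 0) (L.cls Y (subQ L.e c 0)) w +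
      repCount (L.cls X 1) (L.cls Y (subQ L.e c 1)) w + repCount (L.cls X 2) (L.cls Y (subQ L.e c 2)) w +
      repCount (L.cls X 3) (L.cls Y (subQ L.e c 3)) w :=
    fun w hw => L.repCount_le_sum_cls X Y hc (mem_filter.mp hw).2
  refine ⟨L.card_filter_le Z c, ?_, ?_, ?_⟩
  · -- (F1)
    exact f1_of L.P L.card_filter_mem_P _ _ _ _ _ _ _ _ X Y Q Zq v (L.base 0) (L.base (subQ L.e c 0)) (L.base 1) (L.base (subQ L.e c 1))
      (L.base 2) (L.base (subQ L.e c 2)) (L.base 3) (L.base (subQ L.e c 3))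
      (L.sub_base_of_mem_filter X 0) (L.sub_base_of_mem_filter Y _) (L.sub_base_of_mem_filter X 1) (L.sub_base_of_mem_filter Y _)
      (L.sub_base_of_mem_filter X 2) (L.sub_base_of_mem_filter Y _) (L.sub_base_of_mem_filter X 3) (L.sub_base_of_mem_filter Y _)
      (fun w hw => by
        have hw' : L.lab w ≠ c := fun h' => hw (mem_filter.mpr ⟨mem_univ _, h'⟩)
        exact ⟨L.repCount_cls_eq_zero X Y hc (by omega) hw', L.repCount_cls_eq_zero X Y hc (by omega) hw',
          L.repCount_cls_eq_zero X Y hc (by omega) hw', L.repCount_cls_eq_zero X Y hc (by omega) hw'⟩)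
      hdomle hQ hZq (fun w hw => (hrZ w (L.mem_cls.mp hw).1).1)
  · -- (F2)
    exact f2_of _ _ _ _ _ _ _ _ X Y Q Zq vb hdomge hZq (fun w hw => (hrZ w (L.mem_cls.mp hw).1).2)
  · -- (F3)
    intro hW
    obtain ⟨w, hw⟩ := card_pos.mp hW
    have h1 := (hrZ w (L.mem_cls.mp hw).1).2
    have h2 := hdomge w (hZq hw)
    have m0 := le_min (GW2.repCount_le_card_left (L.cls X 0) (L.cls Y (subQ L.e c 0)) w) (GW2.repCount_le_card_right (L.cls X 0) (L.cls Y (subQ L.e c 0)) w)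
    have m1 := le_min (GW2.repCount_le_card_left (L.cls X 1) (L.cls Y (subQ L.e c 1)) w) (GW2.repCount_le_card_right (L.cls X 1) (L.cls Y (subQ L.e c 1)) w)
    have m2 := le_min (GW2.repCount_le_card_left (L.cls X 2) (L.cls Y (subQ L.e c 2)) w) (GW2.repCount_le_card_right (L.cls X 2) (L.cls Y (subQ L.e c 2)) w)
    have m3 := le_min (GW2.repCount_le_card_left (L.cls X 3) (L.cls Y (subQ L.e c 3)) w) (GW2.repCount_le_card_right (L.cls X 3) (L.cls Y (subQ L.e c 3)) w)
    omega

/-- **Form B of rule U11-F4 for an STPP family** (non-empty sets) in a finite abelian group of order `4p` carrying the labelling `L`: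
the class counts of `X, Y, Z′` pass `FormOK`. [original] -/
theorem Lab.formOK_of_isSTPP (h : IsSTPP A B C) (hA : ∀ i, (A i).Nonempty) (hB : ∀ i, (B i).Nonempty) (hC : ∀ i, (C i).Nonempty)
    (hp : p.Prime) {vb : ℕ} (hvb : ∀ i, vb ≤ (B i).card) :
    FormOK p L.e (univ.sup fun i => (B i).card) vb
      (pAB (fun i => (A i).card) (fun i => (B i).card) (fun i => (C i).card))
      (pBC (fun i => (A i).card) (fun i => (B i).card) (fun i => (C i).card))
      (pCA (fun i => (A i).card) (fun i => (B i).card) (fun i => (C i).card))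
      (L.cnt (diffUnion A B)) (L.cnt (diffUnion B C)) (L.cnt (diffUnion A C)) := by
  refine ⟨?_, ?_, ?_, L.cnt_get_le _ (by omega), L.cnt_get_le _ (by omega), L.cnt_get_le _ (by omega), L.cnt_get_le _ (by omega),
    L.cnt_get_le _ (by omega), L.cnt_get_le _ (by omega), L.cnt_get_le _ (by omega), L.cnt_get_le _ (by omega),
    L.targetOK_of_isSTPP h hp hvb (by omega), L.targetOK_of_isSTPP h hp hvb (by omega),
    L.targetOK_of_isSTPP h hp hvb (by omega), L.targetOK_of_isSTPP h hp hvb (by omega)⟩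
  · rw [L.cnt_sum]; exact card_diffUnion_AB h hC
  · rw [L.cnt_sum]; exact card_diffUnion_BC h hA
  · rw [L.cnt_sum]; exact card_diffUnion_AC h hB

omit [Fintype H] in
/-- Swapping the two families negates the difference union: `⋃ (A − C) = −⋃ (C − A)`. [bookkeeping] -/
theorem diffUnion_swap_eq_image_neg (A C : Fin N → Finset H) : diffUnion C A = (diffUnion A C).image (fun u => -u) := by
  ext u
  simp only [diffUnion, mem_image, mem_biUnion, mem_univ, true_and]
  constructor
  · rintro ⟨i, hi⟩
    rw [mem_sub] at hi
    obtain ⟨a, ha, c, hc, rfl⟩ := hi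
    exact ⟨c - a, ⟨i, sub_mem_sub hc ha⟩, by abel⟩
  · rintro ⟨w, ⟨i, hi⟩, rfl⟩
    rw [mem_sub] at hi
    obtain ⟨c, hc, a, ha, rfl⟩ := hi
    exact ⟨i, by rw [neg_sub]; exact sub_mem_sub ha hc⟩

omit [DecidableEq H] in
/-- **Soundness of rule U11-F4**: the shape data of every `IsSTPP` family with non-empty sets in a finite abelian group of order `M` is
`FP4Adm M` (at `M = 4p`: the labelling of `AbelianSTPPCensusFP4Label`; form B is `formOK_of_isSTPP`, forms A and C are form B of the
rotated families `(C, A, B)`, `(B, C, A)`, negation permuting the classes of `⋃(A − C)` / `⋃(C − A)` etc. by `negQ`). [original] -/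
theorem fp4Adm_of_isSTPP {A B C : Fin N → Finset H} (h : IsSTPP A B C)
    (hne : ∀ i, (A i).Nonempty ∧ (B i).Nonempty ∧ (C i).Nonempty) :
    FP4Adm (Fintype.card H) (fun i => (A i).card) (fun i => (B i).card) (fun i => (C i).card) := by
  intro p hM hp hp3 va vb vc hva hvb hvc
  classical
  have hA : ∀ i, (A i).Nonempty := fun i => (hne i).1
  have hB : ∀ i, (B i).Nonempty := fun i => (hne i).2.1
  have hC : ∀ i, (C i).Nonempty := fun i => (hne i).2.2
  obtain ⟨L⟩ := nonempty_lab (H := H) hM hp hp3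
  refine ⟨L.e, L.e_le, L.cnt (diffUnion A B), L.cnt (diffUnion B C), L.cnt (diffUnion A C),
    L.formOK_of_isSTPP h hA hB hC hp hvb, ?_, ?_⟩
  · have h' := L.formOK_of_isSTPP h.rotate.rotate hC hA hB hp hva
    rw [diffUnion_swap_eq_image_neg A C, diffUnion_swap_eq_image_neg B C, L.cnt_image_neg, L.cnt_image_neg] at h'
    exact h'
  · have h' := L.formOK_of_isSTPP h.rotate hB hC hA hp hvc
    rw [diffUnion_swap_eq_image_neg A C, diffUnion_swap_eq_image_neg A B, L.cnt_image_neg, L.cnt_image_neg] at h'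
    exact h'

omit [DecidableEq H] in
/-- **`FP4Sound`** — the rule in the census's item format: every STPP family with non-empty sets in a finite abelian group `H`
satisfies `FP4Adm |H|` at its shape list. [original] -/
theorem fp4Sound : ∀ (H : Type) [AddCommGroup H] [Fintype H] (N : ℕ) (A B C : Fin N → Finset H), IsSTPP A B C →
    (∀ i, (A i).Nonempty ∧ (B i).Nonempty ∧ (C i).Nonempty) →
      FP4Adm (Fintype.card H) (fun i => (A i).card) (fun i => (B i).card) (fun i => (C i).card) := by
  intro H _ _ N A B C h hne
  exact fp4Adm_of_isSTPP h hne

end Sound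

end FP4

end Summit.MatrixMultiplication.MatrixMultiplication.Theorems
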